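import Literature.Computability.QuantumComplexity.ForrelationDerivativeTables
import Literature.Computability.QuantumComplexity.ForrelationDirectSum

/-!
# Crux `CubicForrelation.SignedCubicForrelationNotPrBPP` (stmt-QuantumAdvantage-13931)

Stub `stub_periodicIdentity` of the line `Sketch` (the PERIODIC IDENTITY of card `kernel-descent`).

A Boolean function `b` on `n + 1` bits with a periodic direction (a constant derivative
`D_h b = c`) is, in coordinates with `h = e₀`, `b(x₀, x′) = x₀·c ⊕ B(x′)`. For such a `b` and ANY
Boolean `a` on `n + 1` bits the signed forrelation drops one variable:

  `Φ(a, b) = Φ(a(c, ·), B) / √2`.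

Proof: the unnormalised Walsh transform of `(-1)^b` splits over the first coordinate,
`W_b(u₀, u′) = (Σ_{y₀} (-1)^{y₀ (c ⊕ u₀)}) · W_B(u′) = 2 [u₀ = c] W_B(u′)`, so
`Σ_x (-1)^{a(x)} W_b(x) = 2 Σ_{x′} (-1)^{a(c, x′)} W_B(x′)`, and the normalisations compare as
`√(2^{3(n+1)}) = 2 √2 · √(2^{3n})`, `(2 √2)⁻¹ · 2 = 1/√2`.
-/

noncomputable section

set_option linter.dupNamespace false -- D-0017: single-problem summit ⇒ `QuantumAdvantage.QuantumAdvantage` by design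

namespace Summit.QuantumAdvantage.QuantumAdvantage.Theorems.SignedCubicForrelationNotPrBPP

open Literature.Computability.QuantumComplexity Literature.Computability.Complexity
open Literature.Computability.QuantumComplexity.BuzetChailloux (bxor zeroVec phi phi_signOf)
open Literature.Computability.QuantumComplexity.DerivativeWalsh (W fsum_eq_sum_mul_W phi_eq_fsum)

/-- Splitting a sum over `Fin (k+1) → Bool` along the first coordinate (`Fin.consEquiv`), the
first coordinate outermost. -/
private theorem stub_periodicIdentity_sum_cons (k : ℕ) (g : (Fin (k + 1) → Bool) → ℝ) :
    ∑ x, g x = ∑ p : Bool, ∑ u : Fin k → Bool, g (Fin.cons p u) := by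
  rw [← Fintype.sum_equiv (Fin.consEquiv fun _ => Bool) (fun y => g (Fin.cons y.1 y.2)) g
      (fun _ => rfl), Fintype.sum_prod_type]

/-- Splitting a sum over `Fin (k+1) → Bool` along the first coordinate, the tail outermost. -/
private theorem stub_periodicIdentity_sum_cons_inner (k : ℕ) (g : (Fin (k + 1) → Bool) → ℝ) :
    ∑ x, g x = ∑ u : Fin k → Bool, ∑ p : Bool, g (Fin.cons p u) := by
  rw [stub_periodicIdentity_sum_cons, Finset.sum_comm]

/-- The twist factors over the first coordinate: `(-1)^{(p∷u)·(q∷v)} = (-1)^{pq} · (-1)^{u·v}`. -/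
private theorem stub_periodicIdentity_twist_cons {k : ℕ} (p q : Bool) (u v : Fin k → Bool) :
    twist (Fin.cons p u : Fin (k + 1) → Bool) (Fin.cons q v) = signOf (p && q) * twist u v := by
  unfold twist signOf
  rw [Fin.prod_univ_succ]
  simp only [Fin.cons_zero, Fin.cons_succ]

/-- The `𝔽₂` computation at the heart of the periodic identity: for fixed bits `x₀ c` and any
weight `G` not depending on `y₀`, `Σ_{y₀} (-1)^{y₀ c} (-1)^{y₀ x₀} G = 2 [x₀ = c] G`
(the character sum `Σ_{y₀} (-1)^{y₀ (c ⊕ x₀)}` is `2` if `x₀ = c` and `0` otherwise). -/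
private theorem stub_periodicIdentity_charSum (x₀ c : Bool) (G : ℝ) :
    ∑ y₀ : Bool, signOf (y₀ && c) * (signOf (y₀ && x₀) * G) =
      (if x₀ = c then 2 else 0) * G := by
  simp only [Fintype.sum_bool]
  cases x₀ <;> cases c <;> norm_num [signOf] <;> ring

/-- Collapsing the outer sum: `Σ_{x₀} F(x₀) · (2 [x₀ = c] G) = 2 F(c) G`. -/
private theorem stub_periodicIdentity_collapse (c : Bool) (F : Bool → ℝ) (G : ℝ) :
    ∑ x₀ : Bool, F x₀ * ((if x₀ = c then 2 else 0) * G) = 2 * (F c * G) := by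
  simp only [Fintype.sum_bool]
  cases c <;> norm_num <;> ring

/-- `√(2^{3(n+1)}) = 2 √2 · √(2^{3n})`. -/
private theorem stub_periodicIdentity_sqrt (n : ℕ) :
    Real.sqrt ((2 : ℝ) ^ (3 * (n + 1))) = 2 * Real.sqrt 2 * Real.sqrt ((2 : ℝ) ^ (3 * n)) := by
  rw [sqrt_two_pow_three_mul_add n 1, mul_comm]
  congr 1
  rw [show ((2 : ℝ)) ^ (3 * 1) = 2 ^ 2 * 2 by norm_num, Real.sqrt_mul (by norm_num),
    Real.sqrt_sq (by norm_num)]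

/-- PERIODIC IDENTITY (stub `stub_periodicIdentity` of line `Sketch`, crux stmt-QuantumAdvantage-13931).
For `b(x₀, x′) = x₀·c ⊕ B(x′)` on `n + 1` bits (a cubic with a periodic direction `e₀`,
`D_{e₀} b = c`) and EVERY `a`: `Φ(a, b) = Φ(a(c, ·), B) / √2`. Via
`W_b(x₀, x′) = 2 [x₀ = c] W_B(x′)` and `√(2^{3(n+1)}) = 2 √2 · √(2^{3n})`. -/
theorem stub_periodicIdentity :
    ∀ (n : ℕ) (a : (Fin (n + 1) → Bool) → Bool) (B : (Fin n → Bool) → Bool) (c : Bool),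
      forrelation a (fun x => (x 0 && c) ^^ B (Fin.tail x)) =
        (Real.sqrt 2)⁻¹ * forrelation (fun u => a (Fin.cons c u)) B := by
  intro n a B c
  set b : (Fin (n + 1) → Bool) → Bool := fun x => (x 0 && c) ^^ B (Fin.tail x) with hb
  -- the unnormalised Walsh transform of `(-1)^b` at `(x₀, u)`
  have hW : ∀ (x₀ : Bool) (u : Fin n → Bool),
      W (fun y => signOf (b y)) (Fin.cons x₀ u) =
        (if x₀ = c then 2 else 0) * W (fun v => signOf (B v)) u := by
    intro x₀ u
    unfold W
    rw [stub_periodicIdentity_sum_cons_inner, Finset.mul_sum]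
    refine Finset.sum_congr rfl fun v _ => ?_
    simp only [hb, Fin.cons_zero, Fin.tail_cons, stub_periodicIdentity_twist_cons, signOf_xor]
    rw [← stub_periodicIdentity_charSum x₀ c (signOf (B v) * twist v u)]
    refine Finset.sum_congr rfl fun y₀ _ => ?_
    ring
  -- both sides as sums over `u` of `(-1)^{a(c,u)} · W_B(u)`
  rw [← phi_signOf, phi_eq_fsum, fsum_eq_sum_mul_W, stub_periodicIdentity_sum_cons_inner]
  simp only [hW, stub_periodicIdentity_collapse]
  rw [← phi_signOf, phi_eq_fsum, fsum_eq_sum_mul_W]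
  -- normalisation: `(2 √2 · √(2^{3n}))⁻¹ · 2 = (√2)⁻¹ · (√(2^{3n}))⁻¹`
  rw [stub_periodicIdentity_sqrt n]
  simp only [Finset.mul_sum]
  refine Finset.sum_congr rfl fun u _ => ?_
  ring

end Summit.QuantumAdvantage.QuantumAdvantage.Theorems.SignedCubicForrelationNotPrBPP

end
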